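import Mathlib
import Summits.Ventures.HodgeRepro2.T6NAutToy
import Summits.Ventures.HodgeRepro2.T6N4Main
import Summits.Ventures.HodgeRepro2.T6N4Toy
import Summits.Ventures.HodgeRepro2.T6N42ToyNSide

/-!
# T6N42ToyN4 — the N4 block of the M2 line instantiated jointly on one `NAut` (README §10.5(ii)(d); owner t6-p5)

`N4_main` (t6-p4, T6N4Main) is the N4 block of `periodInputN_of_published` (T6PeriodInput): 62
binders over `M : NAut F P` — per side the six N4.2 binders, the ten N4.3 binders, the three
«obvious» bridges, the nine N4.1 binders, the placement `hunr` (residual AD), the Rallis bridge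
GQT Thm 11.7(ii) and the τ′-refinement `hτ'` (residual IR). The lead's toy `NAut` (T6NAutToy,
`NAutToy.toy F σ₀`) witnesses the carrier and the owners' CONCLUSIONS; its two N4 sides carry a
constant doubling-`L` datum on which the Eischen–Liu binders do not hold. This file takes the
lead's toy and replaces both N4 sides by the joint toy side `N42ToyNSide.toyNSide` (T6N42ToyNSide,
on which the N4.1 + N4.2 + N4.3 binders hold together): on the resulting `toyJ F σ₀ : NAut F
(toyNDatum F σ₀)` EVERY binder of `N4_main` is instantiated — by the owners' toy instances
(t6-p5's T6N42Toy, t6-p6's T6N43Toy, t6-p5's T6N42ToyNSide for N4.1), `fun _ => trivial` for the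
three «obvious» bridges (`thetaNonzero ≡ True` on the toy), t6-p4's `N4Toy.toy_bridges.1`
(`σ = ⊤ ≠ ⊥`) for the Rallis bridge, and t6-p3's `toy_hypI` for `hτ'` — and `N4_main` is APPLIED
(`toyJ_N4_via_N4_main`). The lead's five automorphic binders of `periodInputN_of_mains` hold on
`toyJ` as on the lead's toy (same `d3`, `data`, `d5`; `toyJ_automorphic_binders`). Nothing is
asserted about the N1 binder (the lead's honest limit on the degenerate surface side stands).

README §8(d): uses an L-value-free non-vanishing device: NO (TIER5 §N4, pre-02:16Z lines of
record, continued).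
-/

namespace Summit.Ventures.HodgeRepro2.T6.N42ToyN4

open Summit.Ventures.HodgeRepro2.T6
open Summit.Ventures.HodgeRepro2.T6.N42Toy
open Summit.Ventures.HodgeRepro2.T6.N42ToyNSide

variable {K : Type*} [Field K] [NumberField K]

/-- The lead's toy `NAut` with both N4 sides replaced by the joint toy side `toyNSide`
(everything else — `d3`, `data`, `data_surj`, `d1`, `d5`, the N5 compat fields — as in
`NAutToy.toy F σ₀`). -/
noncomputable def toyJ (F : FaceSetting K) (σ₀ : K →+* ℂ) : NAut F (NAutToy.toyNDatum F σ₀) :=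
  { NAutToy.toy F σ₀ with sA := toyNSide, sB := toyNSide }

/-- Side A of `toyJ` is the joint toy side. -/
theorem toyJ_sA (F : FaceSetting K) (σ₀ : K →+* ℂ) : (toyJ F σ₀).sA = toyNSide := rfl

/-- Side B of `toyJ` is the joint toy side. -/
theorem toyJ_sB (F : FaceSetting K) (σ₀ : K →+* ℂ) : (toyJ F σ₀).sB = toyNSide := rfl

/-- The N3 datum of `toyJ` is t6-p3's toy. -/
theorem toyJ_d3 (F : FaceSetting K) (σ₀ : K →+* ℂ) : (toyJ F σ₀).d3 = N3Toy.toy := rfl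

/-- The Rallis bridge GQT Thm 11.7(ii) on the joint toy: its conclusion `σ ≠ ⊥` holds on t6-p3's
toy side (`σ = ⊤`, t6-p4's `N4Toy.toy_bridges.1`). -/
theorem toy_thm11_7 : Hyp.GQT2014_Thm11_7_ii N3Toy.side toyD41 :=
  fun _ _ => N4Toy.toy_bridges.1

/-- **README §10.5(ii)(d) for the N4 block of the M2 line**: on `toyJ F σ₀` all 62 binders of
`N4_main` are instantiated at once — side A and side B alike, since both sides are `toyNSide` —
and `N4_main` itself yields Proposition N*'s hypothesis (i) on both sides. -/
theorem toyJ_N4_via_N4_main (F : FaceSetting K) (σ₀ : K →+* ℂ) :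
    (toyJ F σ₀).iA ∧ (toyJ F σ₀).iB :=
  N4_main (toyJ F σ₀)
    -- side A: N4.2 (t6-p5's toy instances)
    ⟨fun _ => ⟨toyPair_irreducible, toyPair_smooth⟩,
      fun _ => ⟨trivial_irreducible, trivial_smooth⟩⟩
    (fun _ => Nat.zero_lt_succ 1) (fun _ => Nat.le_succ 2) (fun _ => toyTower_firstLift)
    (fun _ => toyTypeII_minguez) (fun _ => toyTower_ganIchino)
    -- side A: N4.3 (t6-p6's toy instances, the Eischen–Liu binders on `toyD41.Lv (Sum.inr j)`)
    N43Toy.toyU2_char N43Toy.toyU2_EL N43Toy.toyU11_fock N43Toy.toyU11_lowest N43Toy.toyU11_A2f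
    N43Toy.toyU11_EL N43Toy.toyU11_fock N43Toy.toyU11_lowest N43Toy.toyU11_A2f N43Toy.toyU11_EL
    -- side A: the three «obvious» bridges (`thetaNonzero ≡ True` on the toy)
    (fun _ => trivial) (fun _ => trivial) (fun _ => trivial)
    -- side A: N4.1 (T6N42ToyNSide's instances on `toyD41`; `archSet` = the three real places)
    toyD41_GQT toyD41_LR toyD41_padic toyD41_eulerE₁ toyD41_eulerE₂ toyD41_thm31₁ toyD41_thm31₂
    toyD41_prop44₁ toyD41_prop44₂
    -- side A: the placement (vacuous: `S` = all places), the Rallis bridge, the τ′-refinement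
    toyD41_hunr toy_thm11_7 (fun _ => N3Toy.toy_hypI)
    -- side B: the same
    ⟨fun _ => ⟨toyPair_irreducible, toyPair_smooth⟩,
      fun _ => ⟨trivial_irreducible, trivial_smooth⟩⟩
    (fun _ => Nat.zero_lt_succ 1) (fun _ => Nat.le_succ 2) (fun _ => toyTower_firstLift)
    (fun _ => toyTypeII_minguez) (fun _ => toyTower_ganIchino)
    N43Toy.toyU2_char N43Toy.toyU2_EL N43Toy.toyU11_fock N43Toy.toyU11_lowest N43Toy.toyU11_A2f
    N43Toy.toyU11_EL N43Toy.toyU11_fock N43Toy.toyU11_lowest N43Toy.toyU11_A2f N43Toy.toyU11_EL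
    (fun _ => trivial) (fun _ => trivial) (fun _ => trivial)
    toyD41_GQT toyD41_LR toyD41_padic toyD41_eulerE₁ toyD41_eulerE₂ toyD41_thm31₁ toyD41_thm31₂
    toyD41_prop44₁ toyD41_prop44₂
    toyD41_hunr toy_thm11_7 (fun _ => N3Toy.toy_hypI)

/-- The lead's five automorphic binders of `periodInputN_of_mains` hold on `toyJ` exactly as on
the lead's toy (N3A, N3B, N3iso, N5 unchanged; N4 now THROUGH `N4_main` with its binders
instantiated, not by `toy_hypI` directly). -/
theorem toyJ_automorphic_binders (F : FaceSetting K) (σ₀ : K →+* ℂ) :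
    ((toyJ F σ₀).iA → (toyJ F σ₀).iiA → (toyJ F σ₀).ellA) ∧
    ((toyJ F σ₀).iB → (toyJ F σ₀).iiB → (toyJ F σ₀).ellB) ∧
    ((toyJ F σ₀).ellA → (toyJ F σ₀).ellB →
      ∃ c, (NAutToy.toyNDatum F σ₀).AdmChoice c ∧ (toyJ F σ₀).pairing c ≠ 0) ∧
    ((toyJ F σ₀).iA ∧ (toyJ F σ₀).iB) ∧ (toyJ F σ₀).N5 :=
  ⟨fun _ _ => N3Toy.toy_N3A, fun _ _ => N3Toy.toy_N3A,
    fun _ _ => (toyJ F σ₀).exists_choice_of_pairing_ne_zero N3Toy.toy_N3iso,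
    toyJ_N4_via_N4_main F σ₀, N5Toy.toyData_N5⟩

/-- (c) once more: the carrier is inhabited by `toyJ`. -/
theorem nonempty_NAut (F : FaceSetting K) (σ₀ : K →+* ℂ) :
    Nonempty (NAut F (NAutToy.toyNDatum F σ₀)) :=
  ⟨toyJ F σ₀⟩

end Summit.Ventures.HodgeRepro2.T6.N42ToyN4
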